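import Summits.ResolutionOfSingularities.ResolutionOfSingularities.Theorems.StallVertexLockClasses
import Summits.ResolutionOfSingularities.ResolutionOfSingularities.Theorems.MaxContactCutStallVertexFlat
import HarnessLib

/-!
# MaxContactCutStallVertexLock — decomp-res node «StallVertex» (lens-5 g23 rev 9), add-on tree file 4/4: §4k chain
to the target BY NAME (in-cone wiring)

Content VERBATIM from the decomp-res lens-5 tree-ready slices
`HOME/decomp-res-lens-5/g23/parts/StallVertexLock.lean` (fe40ed9c) /
`StallVertexLockClasses.lean` (05ee4541) of the node file `g23/StallVertex.lean` rev 9 (pin fbb7fe50 = rev 8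
9799ca34 + four pure insertions
§1l / §3j / §4k; critic machine diff, CRITIC-LEDGER row 162 DECIDED +1: THE TURN LOCK; HOME =
run/shared/lean/pub/decomp-res; landing order
INBOX :609 / :618).  Landed by decomp-res writer g9 as `StallVertexLockAlgebra` (§1l), `StallVertexLock` (§3j),
`StallVertexLockClasses`
(§4k cells and exact re-locations, cone-free) and the wiring file `MaxContactCutStallVertexLock` (§4k chain to the
target BY NAME); the 420-line
slice is split only to respect the 400-line file cap, declarations and proofs byte-identical.

The two theorems mentioning `MaxContactCut.DefectWalksDeep` (`defectWalksDeep_iff_turnLocked_nullFlat`,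
`closes_turnLocked_nullFlat`) live here so that
the cells file `StallVertexLockClasses` stays importable by the route file (aside home); they read the landed rev-8 wiring
`MaxContactCutStallVertexFlat` (`defectWalksDeep_iff_positive_nullFlat`, `closes_positive_nullFlat`).
-/

noncomputable section

open MvPolynomial Finset
open Literature.AlgebraicGeometry.Resolution
open Literature.AlgebraicGeometry.Resolution.Hauser2010
open Literature.AlgebraicGeometry.Resolution.HauserPerlega2024
open Literature.Barriers.ResolutionOfSingularities
open Literature.AlgebraicGeometry.Resolution.PointBlowup
open Summit.ResolutionOfSingularities.ResolutionOfSingularities.Theses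
open Summit.ResolutionOfSingularities.ResolutionOfSingularities.Theorems.TightDefectClasses
open Summit.ResolutionOfSingularities.ResolutionOfSingularities.Theorems.ProximityCut
open Summit.ResolutionOfSingularities.ResolutionOfSingularities.Theorems.ExitLaw
open Summit.ResolutionOfSingularities.ResolutionOfSingularities.Theorems.DifferentialShade

namespace Summit.ResolutionOfSingularities.ResolutionOfSingularities.Theorems.StallVertex

section Classes

/-- The rev-9 chain to the target BY NAME: `DefectWalksDeep ↔ (A′) ∧ (f) ∧ (TURN-LOCKED POSITIVE) ∧ (NULL-FLAT)`. -/
theorem defectWalksDeep_iff_turnLocked_nullFlat :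
    MaxContactCut.DefectWalksDeep ↔
      NoFreePointTailsDeep ∧ CoefficientCut.NoPlanarJointTailsDeep ∧
        NoTurnLockedPositiveSkewStalledTailsDeep ∧ NoNullFlatSkewStalledTailsDeep := by
  rw [defectWalksDeep_iff_positive_nullFlat, positive_iff_turnLocked]

/-- `closes_turnLocked_nullFlat`: Auxiliary step of this node's calculus, VERBATIM from the lens file (see the
module docstring); the statement is its type. [folklore] -/
theorem closes_turnLocked_nullFlat (hA : NoFreePointTailsDeep) (hP : CoefficientCut.NoPlanarJointTailsDeep)
    (hL : NoTurnLockedPositiveSkewStalledTailsDeep) (hZ : NoNullFlatSkewStalledTailsDeep) :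
    MaxContactCut.DefectWalksDeep :=
  closes_positive_nullFlat hA hP (positive_iff_turnLocked.mpr hL) hZ

end Classes

end Summit.ResolutionOfSingularities.ResolutionOfSingularities.Theorems.StallVertex
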